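import Summits.CriticalPhenomena.Ising3DConformalLimit.Theorems.PrecisionLaplacianDirectCorrelationStableTailPickInversionAux9

/-!
# Pick inversion, auxiliary file 10: weighted Parseval on the Brillouin zone and the cosine
# transform of the Abel-summed Green series

Helper file for stub `stub_pickInversion` of line `self-energy-pick-inversion`, crux
`PrecisionLaplacian.DirectCorrelationStableTail` (stmt-CriticalPhenomena-4799). Pure theorem file.

* `parseval_weighted` (registered sub-goal `stub_pickInversion_auxParseval`): for a summable
  `f : ℤ^d → ℝ`, a finite set `S` and real weights `V`,
  `∫_{[-π,π]^d} f̂_c(k) (∑_{y,y' ∈ S} V y V y' cos(k·(y-y'))) dk = (2π)^d ∑_{y,y' ∈ S} V y V y' f(y-y')`,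
  `f̂_c(k) = ∑_z f(z) cos(k·z)` (the tree's `parseval_block` is `V ≡ 1`);
* `tsum_shift_mul_cos` : `∑_w f(w + u) cos(k·w) = f̂_c(k) cos(k·u)` for even summable `f`;
* `abelGreen_summable_fourier` : for the convolution powers `P` of an even sub-probability `q` and
  `0 ≤ r < 1`, the Abel sum `g_r = ∑_j rʲ P j` is nonnegative, even, summable, and
  `(ĝ_r)_c(k) = 1/(1 - r φ(k))`, `φ(k) = ∑_y q(y) cos(k·y)`.
-/

noncomputable section

namespace Summit.CriticalPhenomena.Ising3DConformalLimit.Cruxes.DirectCorrelationStableTail.SelfEnergyPickInversion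

open Filter Topology Finset Real MeasureTheory Literature.Probability.LatticeModels
open scoped BigOperators
open Summit.CriticalPhenomena.Ising3DConformalLimit.Theorems.EtaBoundsTransfer
  (summable_shear tsum_sub_right convPow_even tsum_even_mul_sin_eq_zero fourier_convPow
    abs_fourier_q_le_one continuous_phase integrableOn_cube_of_continuous integral_cube_cos_mul_cos
    volume_cube_lt_top)

variable {d : ℕ}

/-! ### Weighted Parseval identity -/

/-- **Weighted Parseval identity on the Brillouin zone**: for a summable `f : ℤ^d → ℝ`, a finite
set `S` and real weights `V`,
`∫_{[-π,π]^d} f̂_c(k) · ∑_{y,y' ∈ S} V y V y' cos(k·(y - y')) dk = (2π)^d ∑_{y,y' ∈ S} V y V y' f(y - y')`,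
where `f̂_c(k) = ∑_z f(z) cos(k·z)`. [folklore] -/
theorem parseval_weighted {f : Site d → ℝ} (hf : Summable f) (S : Finset (Site d)) (V : Site d → ℝ) :
    ∫ k in Set.pi Set.univ (fun _ : Fin d => Set.Icc (-π) π),
        (∑' z, f z * Real.cos (phase d k z)) *
          (∑ y ∈ S, ∑ y' ∈ S, V y * V y' * Real.cos (phase d k (y - y')))
      = (2 * π) ^ d * ∑ y ∈ S, ∑ y' ∈ S, V y * V y' * f (y - y') := by
  set K := Set.pi Set.univ (fun _ : Fin d => Set.Icc (-π) π) with hK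
  set μ : Measure (Fin d → ℝ) := volume.restrict K with hμ
  haveI : IsFiniteMeasure μ := ⟨by rw [hμ, Measure.restrict_apply_univ]; exact volume_cube_lt_top⟩
  set W : (Fin d → ℝ) → ℝ := fun k => ∑ y ∈ S, ∑ y' ∈ S, V y * V y' * Real.cos (phase d k (y - y')) with hW
  set B : ℝ := ∑ y ∈ S, ∑ y' ∈ S, |V y| * |V y'| with hB
  have hWcont : Continuous W := by
    simp only [hW]
    refine continuous_finsetSum _ fun y _ => continuous_finsetSum _ fun y' _ => ?_
    have := continuous_phase (d := d) (y - y'); fun_prop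
  have hWbd : ∀ k, |W k| ≤ B := by
    intro k
    simp only [hW, hB]
    calc |∑ y ∈ S, ∑ y' ∈ S, V y * V y' * Real.cos (phase d k (y - y'))|
        ≤ ∑ y ∈ S, |∑ y' ∈ S, V y * V y' * Real.cos (phase d k (y - y'))| := Finset.abs_sum_le_sum_abs _ _
      _ ≤ ∑ y ∈ S, ∑ y' ∈ S, |V y * V y' * Real.cos (phase d k (y - y'))| :=
          Finset.sum_le_sum fun y _ => Finset.abs_sum_le_sum_abs _ _
      _ ≤ ∑ y ∈ S, ∑ y' ∈ S, |V y| * |V y'| :=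
          Finset.sum_le_sum fun y _ => Finset.sum_le_sum fun y' _ => by
            rw [abs_mul, abs_mul]
            exact mul_le_of_le_one_right (by positivity) (Real.abs_cos_le_one _)
  have hB0 : 0 ≤ B := Finset.sum_nonneg fun y _ => Finset.sum_nonneg fun y' _ => by positivity
  set F : Site d → (Fin d → ℝ) → ℝ := fun z k => f z * Real.cos (phase d k z) * W k with hF
  have hFcont : ∀ z, Continuous (F z) := by
    intro z; simp only [hF]; have := continuous_phase (d := d) z; fun_prop
  have hFint : ∀ z, Integrable (F z) μ := fun z => integrableOn_cube_of_continuous (hFcont z)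
  have hFbd : ∀ z k, ‖F z k‖ ≤ |f z| * B := by
    intro z k
    rw [Real.norm_eq_abs, hF]
    simp only
    rw [abs_mul, abs_mul]
    calc |f z| * |Real.cos (phase d k z)| * |W k| ≤ |f z| * 1 * B :=
          mul_le_mul (mul_le_mul_of_nonneg_left (Real.abs_cos_le_one _) (abs_nonneg _)) (hWbd k)
            (abs_nonneg _) (by positivity)
      _ = |f z| * B := by ring
  have hFsum : Summable fun z => ∫ k, ‖F z k‖ ∂μ := by
    refine Summable.of_nonneg_of_le (fun z => integral_nonneg fun k => norm_nonneg _)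
      (fun z => ?_) ((hf.abs.mul_right B).mul_right (μ.real Set.univ))
    calc ∫ k, ‖F z k‖ ∂μ ≤ ∫ k, |f z| * B ∂μ := integral_mono (hFint z).norm (integrable_const _) (hFbd z)
      _ = |f z| * B * μ.real Set.univ := by rw [integral_const, smul_eq_mul]; ring
  -- Step 1: swap integral and sum
  have hswap : ∫ k, (∑' z, f z * Real.cos (phase d k z)) * W k ∂μ = ∑' z, ∫ k, F z k ∂μ := by
    rw [integral_tsum_of_summable_integral_norm hFint hFsum]
    refine integral_congr_ae (Filter.Eventually.of_forall fun k => ?_)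
    simp only [hF]
    rw [← tsum_mul_right]
  -- Step 2: compute each integral
  have hterm : ∀ z, ∫ k, F z k ∂μ = (2 * π) ^ d / 2 * (f z * ∑ y ∈ S, ∑ y' ∈ S,
      V y * V y' * ((if z = y - y' then 1 else 0) + (if z = -(y - y') then 1 else 0))) := by
    intro z
    simp only [hF, hW]
    have h1 : ∀ k : Fin d → ℝ, f z * Real.cos (phase d k z) *
        ∑ y ∈ S, ∑ y' ∈ S, V y * V y' * Real.cos (phase d k (y - y'))
        = ∑ y ∈ S, ∑ y' ∈ S, f z * (V y * V y') * (Real.cos (phase d k z) * Real.cos (phase d k (y - y'))) := by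
      intro k
      rw [Finset.mul_sum]
      refine Finset.sum_congr rfl fun y _ => ?_
      rw [Finset.mul_sum]
      refine Finset.sum_congr rfl fun y' _ => ?_
      ring
    simp_rw [h1]
    have hi : ∀ y y', Integrable (fun k : Fin d → ℝ =>
        f z * (V y * V y') * (Real.cos (phase d k z) * Real.cos (phase d k (y - y')))) μ := by
      intro y y'
      refine integrableOn_cube_of_continuous ?_
      have := continuous_phase (d := d) z; have := continuous_phase (d := d) (y - y'); fun_prop
    rw [integral_finsetSum _ (fun y _ => integrable_finsetSum _ (fun y' _ => hi y y'))]
    simp_rw [integral_finsetSum _ (fun y' _ => hi _ y'), integral_const_mul]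
    rw [Finset.mul_sum, Finset.mul_sum]
    refine Finset.sum_congr rfl fun y _ => ?_
    rw [Finset.mul_sum, Finset.mul_sum]
    refine Finset.sum_congr rfl fun y' _ => ?_
    rw [show (∫ k, Real.cos (phase d k z) * Real.cos (phase d k (y - y')) ∂μ)
        = (2 * π) ^ d / 2 * ((if z = y - y' then 1 else 0) + (if z = -(y - y') then 1 else 0))
        from integral_cube_cos_mul_cos z (y - y')]
    ring
  rw [hswap]
  simp_rw [hterm]
  rw [tsum_mul_left]
  -- Step 3: evaluate the sums of indicators
  have h2 : ∀ z, f z * ∑ y ∈ S, ∑ y' ∈ S,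
      V y * V y' * ((if z = y - y' then (1:ℝ) else 0) + (if z = -(y - y') then 1 else 0))
      = ∑ y ∈ S, ∑ y' ∈ S, ((if z = y - y' then V y * V y' * f z else 0) +
          (if z = -(y - y') then V y * V y' * f z else 0)) := by
    intro z
    rw [Finset.mul_sum]
    refine Finset.sum_congr rfl fun y _ => ?_
    rw [Finset.mul_sum]
    refine Finset.sum_congr rfl fun y' _ => ?_
    split_ifs <;> ring
  simp_rw [h2]
  have hsa : ∀ (w : Site d) (c : ℝ), Summable fun z => (if z = w then c * f z else 0) := by
    intro w c
    apply summable_of_ne_finset_zero (s := {w})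
    intro z hz; rw [Finset.mem_singleton] at hz; rw [if_neg hz]
  have hva : ∀ (w : Site d) (c : ℝ), ∑' z, (if z = w then c * f z else 0) = c * f w := by
    intro w c
    rw [tsum_eq_single w (fun z hz => if_neg hz), if_pos rfl]
  rw [Summable.tsum_finsetSum (fun y _ => summable_sum (fun y' _ => (hsa _ _).add (hsa _ _)))]
  simp_rw [Summable.tsum_finsetSum (fun y' _ => (hsa _ _).add (hsa _ _))]
  have hval : ∀ y y' : Site d, ∑' z, ((if z = y - y' then V y * V y' * f z else 0) +
      (if z = -(y - y') then V y * V y' * f z else 0))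
      = V y * V y' * f (y - y') + V y * V y' * f (y' - y) := by
    intro y y'
    rw [Summable.tsum_add (hsa _ _) (hsa _ _), hva, hva, neg_sub]
  simp_rw [hval]
  have hsymm : ∑ y ∈ S, ∑ y' ∈ S, V y * V y' * f (y' - y) = ∑ y ∈ S, ∑ y' ∈ S, V y * V y' * f (y - y') := by
    rw [Finset.sum_comm]
    exact Finset.sum_congr rfl fun y _ => Finset.sum_congr rfl fun y' _ => by ring
  simp_rw [Finset.sum_add_distrib]
  rw [hsymm]
  ring

/-- **Registered auxiliary stub `stub_pickInversion_auxParseval`** (sub-goal of `stub_pickInversion`):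
the weighted Parseval identity on `[-π,π]³` (`parseval_weighted`). [folklore] -/
theorem stub_pickInversion_auxParseval : ∀ (f : Site 3 → ℝ) (S : Finset (Site 3)) (V : Site 3 → ℝ),
    Summable f →
    ∫ k in Set.pi Set.univ (fun _ : Fin 3 => Set.Icc (-Real.pi) Real.pi),
        (∑' z, f z * Real.cos (∑ i, k i * (z i : ℝ))) *
          (∑ y ∈ S, ∑ y' ∈ S, V y * V y' * Real.cos (∑ i, k i * ((y - y') i : ℝ)))
      = (2 * Real.pi) ^ 3 * ∑ y ∈ S, ∑ y' ∈ S, V y * V y' * f (y - y') :=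
  fun _ S V hf => by
    have h := parseval_weighted hf S V
    simpa only [phase] using h

/-! ### Shifted cosine transforms of even functions -/

/-- For an even summable `f` on `ℤ^d` and `u ∈ ℤ^d`:
`∑_w f(w + u) cos(k·w) = (∑_w f(w) cos(k·w)) cos(k·u)`. [folklore] -/
theorem tsum_shift_mul_cos {f : Site d → ℝ} (hf : Summable f) (hfev : ∀ w, f (-w) = f w)
    (k : Fin d → ℝ) (u : Site d) :
    ∑' w, f (w + u) * Real.cos (phase d k w) = (∑' w, f w * Real.cos (phase d k w)) * Real.cos (phase d k u) := by
  have hs1 : Summable fun w => f w * Real.cos (phase d k w) :=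
    Summable.of_norm_bounded hf.abs fun w => by
      rw [Real.norm_eq_abs, abs_mul]; exact mul_le_of_le_one_right (abs_nonneg _) (Real.abs_cos_le_one _)
  have hs2 : Summable fun w => f w * Real.sin (phase d k w) :=
    Summable.of_norm_bounded hf.abs fun w => by
      rw [Real.norm_eq_abs, abs_mul]; exact mul_le_of_le_one_right (abs_nonneg _) (Real.abs_sin_le_one _)
  calc ∑' w, f (w + u) * Real.cos (phase d k w)
      = ∑' v, (fun w => f (w + u) * Real.cos (phase d k w)) ((Equiv.subRight u) v) :=
        ((Equiv.subRight u).tsum_eq _).symm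
    _ = ∑' v, f v * Real.cos (phase d k (v - u)) :=
        tsum_congr fun v => by simp only [Equiv.subRight_apply, sub_add_cancel]
    _ = ∑' v, (Real.cos (phase d k u) * (f v * Real.cos (phase d k v)) +
          Real.sin (phase d k u) * (f v * Real.sin (phase d k v))) := by
        refine tsum_congr fun v => ?_
        rw [phase_sub, Real.cos_sub]; ring
    _ = Real.cos (phase d k u) * ∑' v, f v * Real.cos (phase d k v) +
          Real.sin (phase d k u) * ∑' v, f v * Real.sin (phase d k v) := by
        rw [Summable.tsum_add (hs1.mul_left _) (hs2.mul_left _), tsum_mul_left, tsum_mul_left]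
    _ = (∑' w, f w * Real.cos (phase d k w)) * Real.cos (phase d k u) := by
        rw [tsum_even_mul_sin_eq_zero hfev k, mul_zero, add_zero, mul_comm]

/-! ### The Abel-summed Green series `g_r = ∑_j rʲ P j` and its cosine transform -/

/-- **The Abel sum of the convolution powers.** For an even sub-probability `q ≥ 0` on `ℤ^d`
with real convolution powers `P` and `0 ≤ r < 1`: the double family `(j, w) ↦ rʲ P j w` is summable,
`g_r(w) = ∑_j rʲ P j w` is nonnegative, even and summable, and its cosine transform is
`∑_w g_r(w) cos(k·w) = (1 - r φ(k))⁻¹`, `φ(k) = ∑_y q(y) cos(k·y)`. [folklore] -/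
theorem abelGreen_summable_fourier {q : Site d → ℝ} {P : ℕ → Site d → ℝ}
    (hq0 : ∀ y, 0 ≤ q y) (hqs : Summable q) (hq1 : ∑' y, q y ≤ 1) (hqev : ∀ y, q (-y) = q y)
    (hP0 : ∀ z, P 0 z = if z = 0 then 1 else 0)
    (hPs : ∀ j z, P (j + 1) z = ∑' y, q y * P j (z - y)) {r : ℝ} (hr0 : 0 ≤ r) (hr1 : r < 1) :
    (Summable fun p : ℕ × Site d => r ^ p.1 * P p.1 p.2) ∧
    (∀ w, 0 ≤ ∑' j, r ^ j * P j w) ∧ (∀ w, ∑' j, r ^ j * P j (-w) = ∑' j, r ^ j * P j w) ∧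
    (Summable fun w => ∑' j, r ^ j * P j w) ∧
    ∀ k : Fin d → ℝ, ∑' w, (∑' j, r ^ j * P j w) * Real.cos (phase d k w) =
      (1 - r * ∑' y, q y * Real.cos (phase d k y))⁻¹ := by
  have hPf := convPow_nonneg_summable hq0 hqs hq1 hP0 hPs
  have hPnn : ∀ j z, 0 ≤ P j z := fun j => (hPf j).1
  have hfam_nn : 0 ≤ fun p : ℕ × Site d => r ^ p.1 * P p.1 p.2 := fun p => mul_nonneg (pow_nonneg hr0 _) (hPnn _ _)
  have hfam : Summable fun p : ℕ × Site d => r ^ p.1 * P p.1 p.2 := by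
    rw [summable_prod_of_nonneg hfam_nn]
    refine ⟨fun j => ?_, ?_⟩
    · show Summable fun w => r ^ j * P j w
      exact (hPf j).2.1.mul_left _
    · show Summable fun j => ∑' w, r ^ j * P j w
      refine Summable.of_nonneg_of_le (fun j => tsum_nonneg fun w => mul_nonneg (pow_nonneg hr0 _) (hPnn _ _))
        (fun j => ?_) (summable_geometric_of_lt_one hr0 hr1)
      rw [tsum_mul_left]
      exact mul_le_of_le_one_right (pow_nonneg hr0 _) (hPf j).2.2
  have hg_nn : ∀ w, 0 ≤ ∑' j, r ^ j * P j w := fun w => tsum_nonneg fun j => mul_nonneg (pow_nonneg hr0 _) (hPnn _ _)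
  have hg_ev : ∀ w, ∑' j, r ^ j * P j (-w) = ∑' j, r ^ j * P j w := fun w =>
    tsum_congr fun j => by rw [convPow_even hqev hP0 hPs j w]
  have hg_sum : Summable fun w => ∑' j, r ^ j * P j w := hfam.prod_symm.prod
  refine ⟨hfam, hg_nn, hg_ev, hg_sum, fun k => ?_⟩
  -- the cosine transform: swap the sums and use `fourier_convPow`
  have hfamc : Summable fun p : ℕ × Site d => r ^ p.1 * P p.1 p.2 * Real.cos (phase d k p.2) :=
    Summable.of_norm_bounded hfam fun p => by
      rw [Real.norm_eq_abs, abs_mul, abs_of_nonneg (hfam_nn p)]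
      exact mul_le_of_le_one_right (hfam_nn p) (Real.abs_cos_le_one _)
  have hφ : |∑' y, q y * Real.cos (phase d k y)| ≤ 1 := abs_fourier_q_le_one hq0 hqs hq1 k
  calc ∑' w, (∑' j, r ^ j * P j w) * Real.cos (phase d k w)
      = ∑' w, ∑' j, r ^ j * P j w * Real.cos (phase d k w) := by
        refine tsum_congr fun w => ?_; rw [← tsum_mul_right]
    _ = ∑' j, ∑' w, r ^ j * P j w * Real.cos (phase d k w) :=
        Summable.tsum_comm (f := fun j w => r ^ j * P j w * Real.cos (phase d k w)) (by exact hfamc)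
    _ = ∑' j, (r * ∑' y, q y * Real.cos (phase d k y)) ^ j := by
        refine tsum_congr fun j => ?_
        have : (fun w => r ^ j * P j w * Real.cos (phase d k w)) = fun w => r ^ j * (P j w * Real.cos (phase d k w)) := by
          funext w; ring
        rw [this, tsum_mul_left, fourier_convPow hq0 hqs hqev hP0 hPs hPnn (fun j => (hPf j).2.1) k j, mul_pow]
    _ = (1 - r * ∑' y, q y * Real.cos (phase d k y))⁻¹ := by
        refine tsum_geometric_of_abs_lt_one ?_
        rw [abs_mul, abs_of_nonneg hr0]
        calc r * |∑' y, q y * Real.cos (phase d k y)| ≤ r * 1 := by gcongr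
          _ < 1 := by linarith

end Summit.CriticalPhenomena.Ising3DConformalLimit.Cruxes.DirectCorrelationStableTail.SelfEnergyPickInversion

end
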